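import Summits.Ventures.CertifiedQuantumChemistry.Statement
import HarnessLib

/-!
# Ventures/CertifiedQuantumChemistry — Rows/ModelPin.lean: the MODEL-PIN record (FORMAT-pin1
# `qchem-modelpin/1`) and the pinned ROW OBJECT (pin + sector + E_core convention) that claim nodes
# and CERTIFIED-CHEM rows quote (LADDER-CHEM I-TYPE slot 10 (ii))

HONEST FRAMING (verbatim, page 1 of every file of the cell): certified bounds for a stated model
Hamiltonian in a stated basis; not a claim about the real molecule or material beyond that model.
CERTIFIED = inequalities on `E₀` (or `ΔE₀`) of files pinned by sha256 from replayed exact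
certificates with typed soundness lemmas; VALIDATED = everything mapping model → reality.

Typer chem-type-10 (LADDER-CHEM cell chem-oracle, I-TYPE slot 10 (ii)), zero compute; RECORD TYPES
and two one-line lemmas; nothing is asserted about any model, no claim node, no instance, no notation.

WHY. `Statement.lean` (DRAFT v0.2) fixes the MODEL as the exact-rational triple `Model k = (h, eri,
ecore)` "AFTER the permutational completion fixed by the MODEL PIN (`FORMAT-pin1.md`: `model_sha256`
identifies exactly this triple)" and says that models too large for Lean literals (ruling K3: no
`> 2·10⁴`-literal files; every transition-metal file of rungs R2/R3: Cr₂ `k = 30`, [2Fe-2S] `k = 20`,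
FeMoco `k = 54 / 76`) "appear in Lean only through claim nodes quoting `model_sha256`". Until now the
pin's fields lived only in the free text of docstrings (`Certificates/*.lean`, `Hamiltonians/*.lean`).
This file gives them a TYPE, so that every claim node / row record quotes the same fields in the same
order and chem-ref-3 / chem-ref-4 can audit them mechanically:

* `ModelPin` — the fields of FORMAT-pin1 (pub-qchem `pub-qchem-rdm/FORMAT-pin1.md` v1, 2026-08-20,
  verbatim): "Two numbers are recorded for every file used anywhere in the cell: 1. `fcidump_sha256` —
  sha256 of the byte stream as read; for a `.gz` file reader A hashes the DECOMPRESSED bytes …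
  Identifies the artefact. 2. `model_sha256` — sha256 of the canonical JSON (sorted keys, separators
  `,:`) of the object `qchem-modelpin/1`:
  `{"format":"qchem-modelpin/1","norb":k,"nelec":N,"ms2":2M,"orbsym":[…]|null,"isym":int,"ecore":"p/q",
  "h":[[p,q,"p/q"] for p<=q, value !=0, sorted],"eri":[[p,q,r,s,"p/q"] canonical 8-fold key, value !=0,
  sorted]}` with 0-based orbitals, `"p/q"` = reduced fraction string … canonical key of (pq|rs) = the
  lexicographically smallest of the 8 equivalent index tuples … Identifies the MATHEMATICS: invariant
  under line order, number formatting, which symmetry copy of an integral the writer printed, and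
  duplicated lines; it CHANGES if any literal changes in any digit. Inconsistent duplicates … are a
  READ ERROR (the file does not define a model), never averaged." and "What is NOT in the pin: … the
  header's NELEC/MS2 are in the pin as integers but the SECTOR a certificate speaks about is stated
  separately (N_α, N_β); point-group labels ARE in the pin (they change nothing in H_F but they license
  the symmetry hints …). UHF (spin-dependent) files: refused in v1." The header integers are those of
  the FCIDUMP namelist (Knowles–Handy 1989: NORB, NELEC, MS2, ORBSYM, ISYM). The two hashes are
  `String`s (64 lowercase hex digits, `ModelPin.IsWellFormedHex`); Lean computes no sha256 — the
  hashes are QUOTED here and CHECKED by the readers of record (A: `fcidump_exact.py`, B: reader B′),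
  exactly as for every claim node of the cell.
* `Model.IsEightfold` — the SYMMETRY RULE of the pin: after completion by the canonical 8-fold key the
  rational tables satisfy the real 8-fold permutational symmetry `(pq|rs) = (qp|rs) = (pq|sr) = (rs|pq)`
  and `h_pq = h_qp`; `Model.IsEightfold.isSymmetric` records that this implies the minimal rule
  `Model.IsSymmetric` actually used by the soundness theorems (`Rows/SectorRows.lean`).
* `PinnedSector` — the OBJECT OF A ROW (LADDER-CHEM §5 rule 2 "ONE object per row: a pinned file (or
  pinned pair) by sha256 + sector"): a pin, the sector `(N_α, N_β)`, and the `E_core` convention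
  (`ecore_in_objective`, FORMAT-qcl1 §11 meta; option `no-ecore`), with the machine-adjudicable row keys
  of START-HERE §3.1 / pub-qchem CERTIFIED.md l.6: `e0[total]@fcidump:<sha8>:Na<a>:Nb<b>` (absolute),
  `e0S0[total]@…` (singlet-restricted), `dE@fcidump:<sha8A>-<sha8B>:Na<a>:Nb<b>` (difference, same
  sector) — rendered by `PinnedSector.absKey` / `singletKey` / `diffKey` so that a claim node's key is
  COMPUTED from its record, not retyped.
* `Model.MatchesPin` — the Lean-checkable part of "this literal model IS the pinned object": `k = norb`,
  the sector is physical (`N_α, N_β ≤ k`), and `F.ecore` is the pin's `ecore` or `0` according to the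
  convention (`Statement.lean`: "`ecore` … `0` if the file's `ecore_flag` says so"); closes by
  `decide`/`norm_num` on literal models. The hash identity itself is reader-side (W4), never kernel-side.

What is NOT here: no sha256 / canonical-JSON implementation (a pin is quoted, not recomputed, in Lean);
no `Decidable` instances (typer lint; the predicates unfold to decidable arithmetic); no row, no claim
node; nothing about certificates (FORMAT-qcl1 / qcu0 are `Rows/SectorRows.lean`'s business).
References: pub-qchem `pub-qchem-rdm/FORMAT-pin1.md` v1 (2026-08-20T22:45Z, rdm-A, FANOUT T-02);
`pub-qchem-rdm/FORMAT-qcl1.md` §11 (meta keys `ecore_in_objective`, `model_sha256`, `fcidump_sha256`,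
`nalpha`, `nbeta`); cell chem-oracle `START-HERE.md` §3.1–§3.2 (row grammar); P. J. Knowles,
N. C. Handy, Comput. Phys. Commun. 54 (1989) 75 (FCIDUMP namelist NORB/NELEC/MS2/ORBSYM/ISYM and body
`value i j k l`) [cite: KnowlesHandy1989, §2 (FCIDUMP format)].
-/

namespace Summit.Ventures.CertifiedQuantumChemistry

/-! ## The MODEL PIN (FORMAT-pin1 `qchem-modelpin/1`) -/

/-- **MODEL-PIN record** (pub-qchem FORMAT-pin1 v1, object `qchem-modelpin/1`): the two hashes and the
header data that identify an integral file (artefact) and the exact-rational model it prints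
(mathematics). Field ↔ JSON key: `fcidumpSha256 ↔ fcidump_sha256`, `modelSha256 ↔ model_sha256`,
`norb ↔ "norb"` (= `k` spatial orbitals = `r` of LADDER-CHEM), `nelec ↔ "nelec"`, `ms2 ↔ "ms2"` (`2M`),
`orbsym ↔ "orbsym"` (`[…]` or `null`), `isym ↔ "isym"`, `ecore ↔ "ecore"` (the exact rational `"p/q"`
the file prints on its `0 0 0 0` line(s), summed). FCIDUMP header per Knowles–Handy.
[cite: KnowlesHandy1989, §2 (FCIDUMP format)] -/
structure ModelPin where
  /-- `fcidump_sha256`: sha256 (64 lowercase hex) of the byte stream as read (DECOMPRESSED bytes for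
  `.gz`) — "Identifies the artefact." -/
  fcidumpSha256 : String
  /-- `model_sha256`: sha256 of the canonical JSON of `qchem-modelpin/1` — "Identifies the
  MATHEMATICS": the exact rational triple `(h, eri, ecore)` after 8-fold completion, with the header
  integers; changes "if any literal changes in any digit". -/
  modelSha256 : String
  /-- `norb` = NORB: number of spatial orbitals `k` (`2k` spin orbitals). -/
  norb : ℕ
  /-- `nelec` = NELEC header integer (recorded; the certified SECTOR is stated separately). -/
  nelec : ℕ
  /-- `ms2` = MS2 header integer `2M`. -/
  ms2 : ℤ
  /-- `orbsym` = ORBSYM point-group labels (1-based irrep labels as printed) or `none` for `null`;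
  "they change nothing in H_F but they license the symmetry hints". -/
  orbsym : Option (List ℕ)
  /-- `isym` = ISYM header integer. -/
  isym : ℤ
  /-- `ecore`: the scalar `E_core` as the exact rational the file prints. -/
  ecore : ℚ

namespace ModelPin

/-- A hash field is well-formed: exactly 64 characters, each a lowercase hexadecimal digit (the
rendering both readers print). A syntactic check only — the VALUE is established by the readers.
[cite: KnowlesHandy1989, §2 (FCIDUMP format)] -/
def IsWellFormedHex (s : String) : Prop :=
  s.length = 64 ∧ ∀ c ∈ s.toList, c ∈ "0123456789abcdef".toList

/-- Both hashes of a pin are well-formed 64-hex strings and, when ORBSYM is present, it carries one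
label per spatial orbital (FORMAT-pin1: a file with and without ORBSYM are different artefacts of the
same `H_F`). [cite: KnowlesHandy1989, §2 (FCIDUMP format)] -/
def IsWellFormed (P : ModelPin) : Prop :=
  IsWellFormedHex P.fcidumpSha256 ∧ IsWellFormedHex P.modelSha256 ∧
    ∀ l : List ℕ, P.orbsym = some l → l.length = P.norb

/-- `<sha8>` of the row grammar: the first 8 hex digits of `fcidump_sha256` ("`<sha8>` = first 8 hex of
the fcidump sha256 of the `.clean` file that IS the model", START-HERE §3.1).
[cite: KnowlesHandy1989, §2 (FCIDUMP format)] -/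
def sha8 (P : ModelPin) : String :=
  String.ofList (P.fcidumpSha256.toList.take 8)

end ModelPin

/-! ## The symmetry rule of the pin on a literal model -/

namespace Model

variable {k : ℕ}

/-- **8-fold symmetry rule** (FORMAT-pin1: "canonical key of (pq|rs) = the lexicographically smallest of
the 8 equivalent index tuples ((p,q) sorted, (r,s) sorted, the two pairs sorted)"): after completion the
exact tables satisfy `h_pq = h_qp` and the real 8-fold permutational symmetry of `(pq|rs)` in chemists'
notation, generated by `(pq|rs) = (qp|rs)`, `(pq|rs) = (pq|sr)`, `(pq|rs) = (rs|pq)`.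
[cite: KnowlesHandy1989, §2 (FCIDUMP format)] -/
def IsEightfold (F : Model k) : Prop :=
  (∀ p q, F.h p q = F.h q p) ∧ (∀ p q r s, F.eri p q r s = F.eri q p r s) ∧
    (∀ p q r s, F.eri p q r s = F.eri p q s r) ∧ ∀ p q r s, F.eri p q r s = F.eri r s p q

/-- The 8-fold rule implies the minimal rule `Model.IsSymmetric` (`h` symmetric, `(pq|rs) = (qp|sr)`)
under which `H_F` is Hermitian and the soundness theorems of `Rows/SectorRows.lean` apply.
[cite: KnowlesHandy1989, §2 (FCIDUMP format)] -/
theorem IsEightfold.isSymmetric {F : Model k} (hF : F.IsEightfold) : F.IsSymmetric :=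
  ⟨hF.1, fun p q r s => (hF.2.1 p q r s).trans (hF.2.2.1 q p r s)⟩

/-- Hence an 8-fold-symmetric literal model has a Hermitian Hamiltonian.
[cite: KnowlesHandy1989, §2 (FCIDUMP format)] -/
theorem IsEightfold.hamiltonian_isHermitian {F : Model k} (hF : F.IsEightfold) :
    F.hamiltonian.IsHermitian :=
  Model.hamiltonian_isHermitian hF.isSymmetric

end Model

/-! ## The pinned ROW OBJECT: pin + sector + `E_core` convention, and its row keys -/

/-- **The object of a row** (LADDER-CHEM §5 rule 2: "a pinned file … by sha256 + sector"): a MODEL PIN,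
the certified sector `(N_α, N_β) = (nalpha, nbeta)` ("the SECTOR a certificate speaks about is stated
separately", FORMAT-pin1) and the `E_core` convention of the row (`ecore_in_objective`, FORMAT-qcl1 §11;
`false` = option `no-ecore`: the Lean model then carries `ecore = 0` and the row's energies exclude
`E_core`). [cite: KnowlesHandy1989, §2 (FCIDUMP format)] -/
structure PinnedSector where
  /-- the MODEL PIN of the integral file -/
  pin : ModelPin
  /-- `N_α` -/
  nalpha : ℕ
  /-- `N_β` -/
  nbeta : ℕ
  /-- `ecore_in_objective`: energies are TOTAL (`E_core` included) iff `true` -/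
  ecoreInObjective : Bool

namespace PinnedSector

/-- The `E_core` value the Lean model of this row carries: the pin's `ecore` if it is in the objective,
else `0` (`Statement.lean`, `Model.ecore`: "`0` if the file's `ecore_flag` says so").
[cite: KnowlesHandy1989, §2 (FCIDUMP format)] -/
def modelEcore (S : PinnedSector) : ℚ :=
  if S.ecoreInObjective then S.pin.ecore else 0

/-- The `[total]` tag of the key grammar: present iff `E_core` is in the objective.
[cite: KnowlesHandy1989, §2 (FCIDUMP format)] -/
def totalTag (S : PinnedSector) : String :=
  if S.ecoreInObjective then "[total]" else ""

/-- The sector suffix `:Na<a>:Nb<b>` of the key grammar. [cite: KnowlesHandy1989, §2 (FCIDUMP format)] -/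
def sectorTag (S : PinnedSector) : String :=
  ":Na" ++ toString S.nalpha ++ ":Nb" ++ toString S.nbeta

/-- ABSOLUTE row key `e0[total]@fcidump:<sha8>:Na<a>:Nb<b>` (START-HERE §3.1; pub-qchem CERTIFIED.md
l.6), computed from the record. [cite: KnowlesHandy1989, §2 (FCIDUMP format)] -/
def absKey (S : PinnedSector) : String :=
  "e0" ++ S.totalTag ++ "@fcidump:" ++ S.pin.sha8 ++ S.sectorTag

/-- SINGLET-RESTRICTED row key `e0S0[total]@fcidump:<sha8>:Na<a>:Nb<b>` (START-HERE §3.1; the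
`Model.singletEnergy` rows of `Statement.lean` v0.2). [cite: KnowlesHandy1989, §2 (FCIDUMP format)] -/
def singletKey (S : PinnedSector) : String :=
  "e0S0" ++ S.totalTag ++ "@fcidump:" ++ S.pin.sha8 ++ S.sectorTag

/-- DIFFERENCE row key, same sector on both files: `dE@fcidump:<sha8A>-<sha8B>:Na<a>:Nb<b>`, meaning
`E₀(H[F_A], N_α, N_β) − E₀(H[F_B], N_α, N_β)` (START-HERE §3.1); the sector and `E_core` convention are
read off the FIRST record (a well-formed pair agrees on both, `IsDiffPair`).
[cite: KnowlesHandy1989, §2 (FCIDUMP format)] -/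
def diffKey (A B : PinnedSector) : String :=
  "dE" ++ A.totalTag ++ "@fcidump:" ++ A.pin.sha8 ++ "-" ++ B.pin.sha8 ++ A.sectorTag

/-- DIFFERENCE row key across sectors: `dE@fcidump:<sha8A>:Na<a>:Nb<b>-<sha8B>:Na<a'>:Nb<b'>`
(START-HERE §3.1, the form "if the two files live in different sectors").
[cite: KnowlesHandy1989, §2 (FCIDUMP format)] -/
def diffKeySectors (A B : PinnedSector) : String :=
  "dE" ++ A.totalTag ++ "@fcidump:" ++ A.pin.sha8 ++ A.sectorTag ++ "-" ++ B.pin.sha8 ++ B.sectorTag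

/-- A same-sector DIFFERENCE PAIR is well formed when both records name the same sector and the same
`E_core` convention (otherwise the difference of TOTAL and electronic energies would be tabled — an
EVENT for chem-ref-4). [cite: KnowlesHandy1989, §2 (FCIDUMP format)] -/
def IsDiffPair (A B : PinnedSector) : Prop :=
  A.nalpha = B.nalpha ∧ A.nbeta = B.nbeta ∧ A.ecoreInObjective = B.ecoreInObjective

/-- The sector of the record is PHYSICAL for its pin: `N_α ≤ norb ∧ N_β ≤ norb` (the range every row
predicate of `Statement.lean` carries; off it `Model.energy` is the junk value `0`).
[cite: KnowlesHandy1989, §2 (FCIDUMP format)] -/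
def IsPhysical (S : PinnedSector) : Prop :=
  S.nalpha ≤ S.pin.norb ∧ S.nbeta ≤ S.pin.norb

end PinnedSector

/-! ## A literal model against its record -/

namespace Model

variable {k : ℕ}

/-- **The Lean-checkable part of "this literal model IS the pinned object".** `F : Model k` MATCHES the
record `S` when `k = norb`, the sector is physical, and `F.ecore` follows the `E_core` convention
(`S.modelEcore`). The hash identity (`model_sha256` of the canonical JSON of `F`'s tables) is NOT a
kernel statement — it is quoted in `S.pin` and established by the two readers of record, as for every
claim node (W4). Closes by `decide` / `norm_num` after `unfold` on literal models.
[cite: KnowlesHandy1989, §2 (FCIDUMP format)] -/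
def MatchesPin (F : Model k) (S : PinnedSector) : Prop :=
  k = S.pin.norb ∧ S.IsPhysical ∧ F.ecore = S.modelEcore

/-- A matching record puts the row on the physical range `N_α ≤ k ∧ N_β ≤ k` of `Statement.lean`'s row
predicates. [cite: KnowlesHandy1989, §2 (FCIDUMP format)] -/
theorem MatchesPin.range {F : Model k} {S : PinnedSector} (h : F.MatchesPin S) :
    S.nalpha ≤ k ∧ S.nbeta ≤ k := by
  obtain ⟨rfl, hphys, -⟩ := h
  exact hphys

end Model

end Summit.Ventures.CertifiedQuantumChemistry
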